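import Summits.CriticalPhenomena.PercolationContinuityZ3.Theorems.PercNearOneGluingNoHeavyLowerTailFKHullPortTASSectionsS
import Summits.CriticalPhenomena.PercolationContinuityZ3.Theorems.PercNearOneGluingNoHeavyLowerTailFKHullPortLemma2
import HarnessLib

/-!
# FK sub-lane: Lemma 2^S (coefficient monotonicity, owner set) for `φ_{𝐩,q}`

Support file (`--supports stmt-CriticalPhenomena-4575`), FK sub-lane `prim-bschramm-fk-2` (gen 3); builds on p205010 (kernel theorem,
internal audit signed; external expert review pending).  No definitions, no named facts, no sorries; standard axioms.

The owner-set copy of `FK.taa_tab_mono` (`…FKHullPortLemma2.lean`, this cell): `a^S(w[e↦1], X∪{b})·b^S(w[e↦0], X) ≤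
a^S(w[e↦0], X)·b^S(w[e↦1], X∪{b})` for a fractional pair `e = s(a,b)` at `X`, from `FK.lemma2_measure_rc` (vdBHK Thm 2.1 for
`φ_{𝐩,q}` via `FK.avoidedCluster_negCorrelation_openPair_rc`) with the avoided set `S ∪ X`.  bschramm/FK-Q2.md §12.6(c).
[cite: VandenbergHaggstromKahn2005, Thm. 2.1 (p. 9), Thm. 1.3 (p. 6)] [cite: Grimmett2006, Thm. (3.1)(a)]
-/

noncomputable section

namespace Summit.CriticalPhenomena.PercolationContinuityZ3.Theorems.FK

open MeasureTheory Set Literature.Probability.LatticeModels Literature.Probability.Percolation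
open Literature.Probability.Percolation.DecisionTree (ind ind_of_mem ind_of_not_mem ind_nonneg)
open Literature.Probability.Percolation.BHK2006 (rcMass delW)
open Summit.CriticalPhenomena.PercolationContinuityZ3.Theorems.HullPort (cut avoidEv connS)
open scoped Classical

variable {V : Type*} [Fintype V]

section Lemma2S

open Literature.Probability.Percolation.BHK2006 (weight rcMass_nonneg coe_delW)
open Summit.CriticalPhenomena.PercolationContinuityZ3.Theorems.HullPort (insert_mem_avoidEv_iff cut_insert_edge edge_mem_cut)

/-- **Lemma 2^S in sum form** (owner set; `a₀ b₁ ≥ a₁ b₀`): for a fractional pair `e = s(a,b)` touching `X` (`a ∈ X`),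
`a^S(w[e↦1], X∪{b})·b^S(w[e↦0], X) ≤ a^S(w[e↦0], X)·b^S(w[e↦1], X∪{b})` — the coefficient `φ(y ↔ z | y ↮ S ∪ X)` is smaller after
contraction than after deletion (`FK.lemma2_measure_rc` with the avoided set `S ∪ X`).
[cite: VandenbergHaggstromKahn2005, Thm. 2.1 (p. 9)] [cite: Grimmett2006, Thm. (3.1)(a)] -/
theorem taaS_tabS_mono (w : Sym2 V → unitInterval) {q : ℝ} (hq : 1 ≤ q) (S : Set V) (y z : V) (X : Set V) {a b : V} (ha : a ∈ X)
    (hab : a ≠ b) (h0 : 0 < ((w s(a, b) : unitInterval) : ℝ)) (h1 : ((w s(a, b) : unitInterval) : ℝ) < 1) :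
    taaS (Function.update w s(a, b) 1) q S y z (insert b X) * tabS (Function.update w s(a, b) 0) q S y X ≤
      taaS (Function.update w s(a, b) 0) q S y z X * tabS (Function.update w s(a, b) 1) q S y (insert b X) := by
  classical
  have hq0 : 0 < q := one_pos.trans_le hq
  set e : Sym2 V := s(a, b) with he
  set w₀ := Function.update w e 0 with hw₀
  set w₁ := Function.update w e 1 with hw₁
  have h1e : ((w₁ e : unitInterval) : ℝ) = 1 := by simp [hw₁]
  have h0e : ((w₀ e : unitInterval) : ℝ) = 0 := by simp [hw₀]
  rw [taaS_absorb w₁ q S y z a b X ha h1e, tabS_absorb w₁ q S y a b X ha h1e]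
  set D : Set (BondConfig V) := avoidEv y (S ∪ X) with hD
  set O : Set (BondConfig V) := {ω | e ∈ ω} with hO
  set Zev : Set (BondConfig V) := openConn y z with hZev
  set t : ℝ := ((w e : unitInterval) : ℝ) with ht
  -- the four masses as multiples of the corner quantities
  have hS : ∀ (A : Set (BondConfig V)), (rcMeasureW w q ∅).real A * rcPartitionFunctionW w q ∅ =
      ∑ ω, rcWeightW w q ∅ ω * ind A ω := by
    intro A
    rw [rcMeasureW_real_eq_sum_div w hq0 ∅ A, div_mul_cancel₀ _ (rcPartitionFunctionW_pos w hq0 ∅).ne']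
  have z1 : ∀ ω, e ∉ ω → rcWeightW w₁ q ∅ ω = 0 := fun ω hω => rcWeightW_eq_zero_of_one_not_mem w₁ q ∅ h1e hω
  have z0 : ∀ ω, e ∈ ω → rcWeightW w₀ q ∅ ω = 0 := fun ω hω => rcWeightW_eq_zero_of_zero_mem w₀ q ∅ h0e hω
  have mO : ∀ (A : Set (BondConfig V)), ∑ ω, rcWeightW w q ∅ ω * ind (A ∩ O) ω = t * ∑ ω, rcWeightW w₁ q ∅ ω * ind A ω := by
    intro A
    rw [Finset.mul_sum]
    refine Finset.sum_congr rfl fun ω _ => ?_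
    rw [rcWeightW_split w q ∅ e ω]
    by_cases heω : e ∈ ω
    · rw [if_pos heω]
      have : ind (A ∩ O) ω = ind A ω := by
        by_cases hA : ω ∈ A
        · rw [ind_of_mem hA, ind_of_mem (Set.mem_inter hA heω)]
        · rw [ind_of_not_mem hA, ind_of_not_mem (fun h => hA h.1)]
      rw [this]; ring
    · rw [if_neg heω, ind_of_not_mem (fun h : ω ∈ A ∩ O => heω h.2), z1 ω heω]; ring
  have mOc : ∀ (A : Set (BondConfig V)), ∑ ω, rcWeightW w q ∅ ω * ind (A ∩ Oᶜ) ω = (1 - t) * ∑ ω, rcWeightW w₀ q ∅ ω * ind A ω := by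
    intro A
    rw [Finset.mul_sum]
    refine Finset.sum_congr rfl fun ω _ => ?_
    rw [rcWeightW_split w q ∅ e ω]
    by_cases heω : e ∈ ω
    · rw [if_pos heω, ind_of_not_mem (fun h : ω ∈ A ∩ Oᶜ => h.2 heω), z0 ω heω]; ring
    · rw [if_neg heω]
      have : ind (A ∩ Oᶜ) ω = ind A ω := by
        by_cases hA : ω ∈ A
        · rw [ind_of_mem hA, ind_of_mem (Set.mem_inter hA heω)]
        · rw [ind_of_not_mem hA, ind_of_not_mem (fun h => hA h.1)]
      rw [this]; ring
  -- the measure-level inequality, multiplied out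
  have hL := lemma2_measure_rc w hq (S ∪ X) (y := y) (z := z) (Set.mem_union_right _ ha) hab
  have hDset : {ω : BondConfig V | ∀ t ∈ S ∪ X, ¬ (openGraph ω).Reachable y t} = D := rfl
  rw [hDset, ← he] at hL
  have hZ := rcPartitionFunctionW_pos w hq0 ∅
  have hL' : (∑ ω, rcWeightW w q ∅ ω * ind (D ∩ Zev ∩ O) ω) * (∑ ω, rcWeightW w q ∅ ω * ind (D ∩ Oᶜ) ω) ≤
      (∑ ω, rcWeightW w q ∅ ω * ind (D ∩ Zev ∩ Oᶜ) ω) * (∑ ω, rcWeightW w q ∅ ω * ind (D ∩ O) ω) := by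
    rw [← hS, ← hS, ← hS, ← hS]
    have := mul_le_mul_of_nonneg_right hL (mul_nonneg hZ.le hZ.le)
    nlinarith [this]
  rw [mO (D ∩ Zev), mOc D, mOc (D ∩ Zev), mO D] at hL'
  -- identify the corner sums with `taa`, `tab`
  have ea : ∀ (u : Sym2 V → unitInterval), ∑ ω, rcWeightW u q ∅ ω * ind (D ∩ Zev) ω = taaS u q S y z X := fun u => rfl
  have eb : ∀ (u : Sym2 V → unitInterval), ∑ ω, rcWeightW u q ∅ ω * ind D ω = tabS u q S y X := fun u => rfl
  rw [ea, eb, ea, eb] at hL'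
  have ht0 : 0 < t := h0
  have ht1 : t < 1 := h1
  have hpos : 0 < t * (1 - t) := mul_pos ht0 (sub_pos.2 ht1)
  have key : t * (1 - t) * (taaS w₁ q S y z X * tabS w₀ q S y X) ≤ t * (1 - t) * (taaS w₀ q S y z X * tabS w₁ q S y X) := by
    nlinarith [hL']
  exact le_of_mul_le_mul_left key hpos

end Lemma2S

end Summit.CriticalPhenomena.PercolationContinuityZ3.Theorems.FK

end
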